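import Summits.BirchSwinnertonDyer.BirchSwinnertonDyer.Theorems.Rank2ObservatoryRank3LeadingTerm
import Summits.BirchSwinnertonDyer.Rank1Residual.AdditivePotMult.RegulatorIndexSquare
import HarnessLib

/-!
# BirchSwinnertonDyer — rank ≥ 2 observatory: rank-3 census — the REGULATOR SIDE per row: `Reg(P₁,P₂,P₃) = n²·Reg(E)` for the table's listed points, `n` the index of `ℤP₁+ℤP₂+ℤP₃+E(ℚ)_tors`

HONEST FRAMING: per-curve certified theorems and census instruments; no claim on BSD in rank ≥ 2.
Nothing here proves BSD, computes a regulator, or shows that the listed points generate for any row.  This file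
types the one relation between the census's SATURATION/GENERATORS side (kernel: the listed span
`Λ = ℤP₁ + ℤP₂ + ℤP₃ + E(ℚ)_tors` of the table's three points has finite index `n` prime to `210`, every prime
factor of `n` is `≥ 11`; GENERATORS under the engine's named hypothesis «index ≤ 10», `Rank3Joins112.*`) and the
REGULATOR entering the BSD quantity (`WeierstrassCurve.regulator`, the determinant of the height pairing on a
Mordell–Weil basis), so far related only in prose: Siksek's identity (27) `Reg(E) = Reg(P₁,…,P_r)/n²` (Gross's
remark after PCMI Def. 1.6; Cremona §3.4–3.5: the tables' regulator is computed from the listed generators).  The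
lattice lemma is the landed `Rank1Residual.AdditivePotMult.regulatorOf_eq_index_sq_mul_regulator` (any number
field); here it is glued to the census convention (points, independence and the index of `Λ` all IN `E(ℚ)`):
* §0 (any `E` over a number field `K`, then `E/ℚ`): independent points stay independent modulo torsion,
  `[E(K) : ⟨P⟩ + tors] = [E(K)/tors : ⟨P̄⟩]`; for three independent points on a curve of rank `3`
  **`Reg(P₁,P₂,P₃) = n²·Reg(E)`**, `Reg(P) > 0`, `Reg(P) = Reg(E) ↔ Λ = E(ℚ) ⇒` Mordell–Weil basis; when every
  prime factor of `n` is `≥ 11`, the DICHOTOMY `Reg(P) = Reg(E)` or `Reg(P) ≥ 121·Reg(E)`, i.e.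
  `Λ = E(ℚ) ↔ Reg(P) < 121·Reg(E)` — the register hypothesis «index ≤ 10» read on the regulator side.
* §1 per row (hypothesis-free on the 9 375 rows of `Rank3KernelRankCensusN9375`; `hup` for the 112 residual rows):
  `Reg(P₁,P₂,P₃) = n²·Reg(E)` with the TABLE's points, `Reg(P) > 0` (all 9 487 rows), the dichotomy, the two `↔`.
* §2 granting «index ≤ 10» (or `Λ = E(ℚ)`): the table's points ARE a Mordell–Weil basis, `Reg(E) = Reg(P)` and
  the BSD quantity reads `#Ш·Reg(P)·Ω·∏c_p/(#E(ℚ)_tors)²` with the table's points.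
* §3 granting `BSDConjecture` (via `Rank3Row.shaOrder_eq_of_bsd_of_mem_rows9375`): with the table's points,
  `L‴(E,1) = 6·#Ш·Reg(P)·Ω·∏c_p/((#E(ℚ)_tors)²·n²)` and `#Ш = n² · L‴(E,1)·(#E(ℚ)_tors)²/(6·Reg(P)·Ω·∏c_p)` — the
  «analytic Ш» computed from the LISTED points is `#Ш/n²` (Cremona's caveat: generators vs. a finite-index subgroup).
* §4 row `0` by name: the table's points of `5077a1` are Buhler–Gross–Zagier's `P₁, P₂, P₀`; hypothesis-free
  `Reg(P₁,P₂,P₀) = n²·Reg(5077a1)`, prime factors of `n` `≥ 11`, and BGZ's «`P₀, P₁, P₂` generate `E(ℚ)`» is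
  EQUIVALENT to `Reg(P₁,P₂,P₀) = Reg(E)`.  §5 aggregates over the 9 375 pairwise distinct curves.

NOT in the kernel, not claimed: `n = 1` for any row; any VALUE of `Reg`, `Ω`, `#Ш`, `c_p`, `#E(ℚ)_tors`; `Ш`
finite.  Pure glue BY NAME — no definitions, no data, no numerics.  Sorry-free; no new axioms.
References: Siksek, Rocky Mountain J. Math. 25 (1995) §3 (27), Thm. 3.1; Gross, PCMI 18 (2011) Lect. 1 Def. 1.6;
Cremona, Algorithms for Modular Elliptic Curves (1997) §3.4–3.5, Table 4; Buhler–Gross–Zagier, Math. Comp. 44 (1985)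
§2; Silverman, AEC (2009) VIII.6.7, VIII.9; Wiles, Clay text (2006) §1.
-/

-- single-conjunct summit: `Summit.BirchSwinnertonDyer.BirchSwinnertonDyer.…` repeats the name by design
set_option linter.dupNamespace false

namespace Summit.BirchSwinnertonDyer.BirchSwinnertonDyer.Rank2Observatory

open Literature Literature.NumberTheory.EllipticCurves WeierstrassCurve
open Summit.BirchSwinnertonDyer.Rank1Residual.AdditivePotMult (regulatorOf_eq_index_sq_mul_regulator)
open Rank3CensusAudit (residualRows112 rank_eq_three_of_mem_rank3Table112)

/-! ### §0 Generic glue -/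

section Lattice

variable {A : Type*} [AddCommGroup A]

/-- `ℤ`-independent elements of an abelian group have `ℤ`-independent classes modulo torsion (a relation among the
classes times the order of the torsion element it produces is a relation in `A`). [cite: SilvermanAEC2009, Thm. VIII.6.7] -/
theorem linearIndependent_mk_of_linearIndependent {ι : Type*} {P : ι → A} (hP : LinearIndependent ℤ P) :
    LinearIndependent ℤ (QuotientAddGroup.mk ∘ P : ι → A ⧸ AddCommGroup.torsion A) := by
  classical
  rw [linearIndependent_iff'] at hP ⊢
  intro s g hg i hi
  have h0 : QuotientAddGroup.mk' (AddCommGroup.torsion A) (∑ j ∈ s, g j • P j) = 0 := by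
    simpa only [map_sum, map_zsmul, QuotientAddGroup.mk'_apply, Function.comp_apply] using hg
  obtain ⟨n, hn, hn0⟩ :=
    ((AddCommGroup.mem_torsion _).mp ((QuotientAddGroup.eq_zero_iff _).mp h0)).exists_nsmul_eq_zero
  have h1 : ∑ j ∈ s, ((n : ℤ) * g j) • P j = 0 := by
    rw [← hn0, Finset.smul_sum]
    exact Finset.sum_congr rfl fun j _ => by rw [mul_smul, natCast_zsmul]
  exact (mul_eq_zero.mp (hP s (fun j => (n : ℤ) * g j) h1 i hi)).resolve_left (by exact_mod_cast hn.ne')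

/-- `[A : ⟨P⟩ + A_tors] = [A/A_tors : ⟨P̄⟩]` (third isomorphism theorem). [cite: Siksek1995, §3 (27), p. 1522] -/
theorem index_closure_sup_torsion_eq {ι : Type*} (P : ι → A) :
    (AddSubgroup.closure (Set.range P) ⊔ AddCommGroup.torsion A).index =
      (AddSubgroup.closure (Set.range (QuotientAddGroup.mk ∘ P : ι → A ⧸ AddCommGroup.torsion A))).index := by
  rw [show (QuotientAddGroup.mk ∘ P : ι → A ⧸ AddCommGroup.torsion A) =
      QuotientAddGroup.mk' (AddCommGroup.torsion A) ∘ P from rfl, Set.range_comp, ← AddMonoidHom.map_closure,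
    ← AddSubgroup.index_comap_of_surjective _ (QuotientAddGroup.mk'_surjective _),
    AddSubgroup.comap_map_eq, QuotientAddGroup.ker_mk']

/-- `⟨P⟩ + A_tors = A ⇒ ⟨P̄⟩ = A/A_tors`. [cite: SilvermanAEC2009, Thm. VIII.6.7] -/
theorem closure_range_mk_eq_top {ι : Type*} {P : ι → A}
    (h : AddSubgroup.closure (Set.range P) ⊔ AddCommGroup.torsion A = ⊤) :
    AddSubgroup.closure (Set.range (QuotientAddGroup.mk ∘ P : ι → A ⧸ AddCommGroup.torsion A)) = ⊤ := by
  have hm := congrArg (AddSubgroup.map (QuotientAddGroup.mk' (AddCommGroup.torsion A))) h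
  have hb : AddSubgroup.map (QuotientAddGroup.mk' (AddCommGroup.torsion A)) (AddCommGroup.torsion A) = ⊥ :=
    (AddSubgroup.map_eq_bot_iff _).mpr (by rw [QuotientAddGroup.ker_mk'])
  rwa [AddSubgroup.map_sup, AddSubgroup.map_top_of_surjective _ (QuotientAddGroup.mk'_surjective _), hb,
    sup_bot_eq, AddMonoidHom.map_closure, ← Set.range_comp] at hm

omit [AddCommGroup A] in
/-- `{P₁, P₂, P₃}` is the range of the family `(P₁, P₂, P₃)`. [folklore] -/
theorem range_triple (P₁ P₂ P₃ : A) : Set.range ![P₁, P₂, P₃] = {P₁, P₂, P₃} := by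
  ext x
  simp only [Set.mem_range, Set.mem_insert_iff, Set.mem_singleton_iff]
  refine ⟨by rintro ⟨i, rfl⟩; fin_cases i <;> simp, ?_⟩
  rintro (rfl | rfl | rfl)
  exacts [⟨0, rfl⟩, ⟨1, rfl⟩, ⟨2, rfl⟩]

end Lattice

section NumberField

open scoped Classical

variable {K : Type*} [Field K] (W : WeierstrassCurve K)

/-- **`Reg(P₁,P₂,P₃) = n²·Reg(E)`** for three `ℤ`-independent points of an elliptic curve of rank `3` over a number
field, `n = [E(K) : ℤP₁+ℤP₂+ℤP₃+E(K)_tors]` (Siksek (27); Gross after Def. 1.6). [cite: Siksek1995, §3 (27), p. 1522] [cite: Gross2011, Lecture 1 §4, Def. 1.6] -/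
theorem regulatorOf_triple_eq_of_numberField [NumberField K] [W.IsElliptic] {P₁ P₂ P₃ : W.toAffine.Point}
    (hli : LinearIndependent ℤ ![P₁, P₂, P₃]) (hr : W.mordellWeilRank = 3) :
    regulatorOf ![P₁, P₂, P₃] =
      ((AddSubgroup.closure {P₁, P₂, P₃} ⊔ AddCommGroup.torsion _).index : ℝ) ^ 2 * W.regulator := by
  rw [← range_triple, index_closure_sup_torsion_eq]
  exact regulatorOf_eq_index_sq_mul_regulator (linearIndependent_mk_of_linearIndependent hli)
    (by rw [Fintype.card_fin, hr])

/-- Independent points with `ℤP₁+ℤP₂+ℤP₃+E(K)_tors = E(K)` form a Mordell–Weil basis (their classes are a `ℤ`-basis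
of `E(K)/tors`). [cite: SilvermanAEC2009, Thm. VIII.6.7] [cite: CremonaAlgorithms1997, §3.5] -/
theorem isMordellWeilBasis_triple_of_numberField {P₁ P₂ P₃ : W.toAffine.Point}
    (hli : LinearIndependent ℤ ![P₁, P₂, P₃])
    (htop : AddSubgroup.closure {P₁, P₂, P₃} ⊔ AddCommGroup.torsion _ = ⊤) :
    IsMordellWeilBasis ![P₁, P₂, P₃] := by
  rw [← range_triple] at htop
  refine And.intro (linearIndependent_mk_of_linearIndependent hli) (Submodule.toAddSubgroup_injective ?_)
  rw [Submodule.span_int_eq_addSubgroupClosure, Submodule.top_toAddSubgroup]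
  exact closure_range_mk_eq_top htop

end NumberField

section Rat

variable (W : WeierstrassCurve ℚ)

/-- **`Reg(P₁,P₂,P₃) = n²·Reg(E)` over `ℚ`** in the census convention (points, independence and the index
`n = [E(ℚ) : ℤP₁+ℤP₂+ℤP₃+E(ℚ)_tors]` all IN `E(ℚ)`), rank `3`. [cite: Siksek1995, §3 (27), p. 1522]
[cite: Gross2011, Lecture 1 §4, Def. 1.6] [cite: CremonaAlgorithms1997, §3.4] -/
theorem regulatorOf_triple_eq [W.IsElliptic] {P₁ P₂ P₃ : W.toAffine.Point}
    (hli : LinearIndependent ℤ ![P₁, P₂, P₃]) (hr : W.mordellWeilRank = 3) :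
    regulatorOf ![P₁, P₂, P₃] =
      ((AddSubgroup.closure {P₁, P₂, P₃} ⊔ AddCommGroup.torsion _).index : ℝ) ^ 2 * W.regulator := by
  convert regulatorOf_triple_eq_of_numberField W (P₁ := P₁) (P₂ := P₂) (P₃ := P₃) (by convert hli using 3) hr
    using 4
  congr!

/-- `Reg(P₁,P₂,P₃) = det ⟨Pᵢ,Pⱼ⟩ > 0` for independent points of `E(ℚ)` (positive-definiteness of the height pairing
modulo torsion, tree `regulatorOf_pos_of_linearIndependent`). [cite: SilvermanAEC2009, Cor. VIII.9.7] -/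
theorem regulatorOf_triple_pos [W.IsElliptic] {P₁ P₂ P₃ : W.toAffine.Point}
    (hli : LinearIndependent ℤ ![P₁, P₂, P₃]) : 0 < regulatorOf ![P₁, P₂, P₃] :=
  regulatorOf_pos_of_linearIndependent
    (@linearIndependent_mk_of_linearIndependent _ (_) _ _ (by convert hli using 3))

/-- `ℤP₁+ℤP₂+ℤP₃+E(ℚ)_tors = E(ℚ)` with independent `Pᵢ` ⇒ `(P₁,P₂,P₃)` is a Mordell–Weil basis of `E(ℚ)`.
[cite: SilvermanAEC2009, Thm. VIII.6.7] [cite: CremonaAlgorithms1997, §3.5] -/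
theorem isMordellWeilBasis_triple {P₁ P₂ P₃ : W.toAffine.Point} (hli : LinearIndependent ℤ ![P₁, P₂, P₃])
    (htop : AddSubgroup.closure {P₁, P₂, P₃} ⊔ AddCommGroup.torsion _ = ⊤) :
    IsMordellWeilBasis ![P₁, P₂, P₃] :=
  isMordellWeilBasis_triple_of_numberField W (by convert hli using 3) (by convert htop using 0; congr!)

/-- **`Reg(P₁,P₂,P₃) = Reg(E) ↔ ℤP₁+ℤP₂+ℤP₃+E(ℚ)_tors = E(ℚ)`** (rank `3`, independent points: `n² = 1 ↔ n = 1`).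
[cite: Siksek1995, §3 (27), p. 1522] [cite: CremonaAlgorithms1997, §3.5] -/
theorem regulatorOf_triple_eq_regulator_iff [W.IsElliptic] {P₁ P₂ P₃ : W.toAffine.Point}
    (hli : LinearIndependent ℤ ![P₁, P₂, P₃]) (hr : W.mordellWeilRank = 3) :
    regulatorOf ![P₁, P₂, P₃] = W.regulator ↔ AddSubgroup.closure {P₁, P₂, P₃} ⊔ AddCommGroup.torsion _ = ⊤ := by
  rw [← AddSubgroup.index_eq_one, regulatorOf_triple_eq W hli hr]
  refine ⟨fun h => ?_, fun h => by rw [h]; simp⟩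
  have h1 : (((AddSubgroup.closure {P₁, P₂, P₃} ⊔ AddCommGroup.torsion _).index : ℕ) : ℝ) ^ 2 = 1 :=
    mul_right_cancel₀ W.regulator_pos'.ne' (h.trans (one_mul _).symm)
  exact Nat.eq_one_of_mul_eq_one_right (by rw [← sq]; exact_mod_cast h1)

/-- **The DICHOTOMY.** If every prime factor of `n` is `≥ 11` (the census: `Λ` is `2,3,5,7`-saturated), then
`Reg(P) = Reg(E)` (`n = 1`) or `Reg(P) ≥ 121·Reg(E)` (`n ≥ 11`). [cite: Siksek1995, §3 (27) and Thm. 3.1, pp. 1522–1524]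
[cite: CremonaAlgorithms1997, §3.5] -/
theorem regulatorOf_triple_dichotomy [W.IsElliptic] {P₁ P₂ P₃ : W.toAffine.Point}
    (hli : LinearIndependent ℤ ![P₁, P₂, P₃]) (hr : W.mordellWeilRank = 3)
    (h11 : ∀ p : ℕ, p.Prime → p ∣ (AddSubgroup.closure {P₁, P₂, P₃} ⊔ AddCommGroup.torsion _).index → 11 ≤ p) :
    regulatorOf ![P₁, P₂, P₃] = W.regulator ∨ 121 * W.regulator ≤ regulatorOf ![P₁, P₂, P₃] := by
  have key := regulatorOf_triple_eq W hli hr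
  rcases eq_or_ne (AddSubgroup.closure {P₁, P₂, P₃} ⊔ AddCommGroup.torsion _).index 1 with h1 | h1
  · left; rw [key, h1]; simp
  · right
    have hn0 : (AddSubgroup.closure {P₁, P₂, P₃} ⊔ AddCommGroup.torsion _).index ≠ 0 := fun h0 => by
      have hpos := regulatorOf_triple_pos W hli
      rw [key, h0] at hpos; simp at hpos
    obtain ⟨p, hp, hpd⟩ := Nat.exists_prime_and_dvd h1
    have h11n : (11 : ℝ) ≤ (AddSubgroup.closure {P₁, P₂, P₃} ⊔ AddCommGroup.torsion _).index := by
      exact_mod_cast (h11 p hp hpd).trans (Nat.le_of_dvd (Nat.pos_of_ne_zero hn0) hpd)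
    rw [key]
    exact mul_le_mul_of_nonneg_right (by nlinarith) W.regulator_pos'.le

/-- **«index ≤ 10» on the regulator side**: with every prime factor of `n` at least `11`,
`ℤP₁+ℤP₂+ℤP₃+E(ℚ)_tors = E(ℚ) ↔ Reg(P₁,P₂,P₃) < 121·Reg(E)`. [cite: Siksek1995, §3 Thm. 3.1, p. 1524] [cite: CremonaAlgorithms1997, §3.5] -/
theorem closure_sup_torsion_eq_top_iff_regulatorOf_lt [W.IsElliptic] {P₁ P₂ P₃ : W.toAffine.Point}
    (hli : LinearIndependent ℤ ![P₁, P₂, P₃]) (hr : W.mordellWeilRank = 3)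
    (h11 : ∀ p : ℕ, p.Prime → p ∣ (AddSubgroup.closure {P₁, P₂, P₃} ⊔ AddCommGroup.torsion _).index → 11 ≤ p) :
    AddSubgroup.closure {P₁, P₂, P₃} ⊔ AddCommGroup.torsion _ = ⊤ ↔
      regulatorOf ![P₁, P₂, P₃] < 121 * W.regulator := by
  rw [← regulatorOf_triple_eq_regulator_iff W hli hr]
  have hR := W.regulator_pos'
  refine ⟨fun h => by rw [h]; linarith, fun h => ?_⟩
  rcases regulatorOf_triple_dichotomy W hli hr h11 with h' | h'
  · exact h'
  · exact absurd h (not_lt.mpr h')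

end Rat

/-! ### §1 Per row of the rank-3 census: the TABLE's listed points -/

/-- **`Reg(P₁,P₂,P₃) > 0` for the listed points of EVERY table row (9 487; independence is kernel).** [cite: SilvermanAEC2009, Cor. VIII.9.7] -/
theorem Rank3Row.regulatorOf_gens_pos_of_mem {r : Rank3Row} (hr : r ∈ rank3Table) (h : r.check = true) :
    0 < regulatorOf ![r.gen₁ h, r.gen₂ h, r.gen₃ h] := by
  haveI := isElliptic_of_mem hr
  exact regulatorOf_triple_pos r.curve (SatCensus.twoSaturated_of_mem_rank3Table hr h).2

/-- **THE REGULATOR SIDE keyed on the rank**: a table row with `rank_ℤ E(ℚ) = 3` has `Reg(P₁,P₂,P₃) = n²·Reg(E)`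
for ITS listed points (`n` the index of the listed span, every prime factor `≥ 11`), so `Reg(P) = Reg(E)` or
`Reg(P) ≥ 121·Reg(E)`, and `Λ = E(ℚ) ↔ Reg(P) = Reg(E) ↔ Reg(P) < 121·Reg(E)`. [cite: Siksek1995, §3 (27), p. 1522]
[cite: CremonaAlgorithms1997, §3.5] [cite: Gross2011, Lecture 1 §4, Def. 1.6] -/
theorem Rank3Row.regulatorSide_of_rank {r : Rank3Row} (hr : r ∈ rank3Table) (h : r.check = true)
    (hrk : r.curve.mordellWeilRank = 3) :
    regulatorOf ![r.gen₁ h, r.gen₂ h, r.gen₃ h] =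
        ((AddSubgroup.closure {r.gen₁ h, r.gen₂ h, r.gen₃ h} ⊔ AddCommGroup.torsion _).index : ℝ) ^ 2 *
          r.curve.regulator ∧
      (regulatorOf ![r.gen₁ h, r.gen₂ h, r.gen₃ h] = r.curve.regulator ∨
        121 * r.curve.regulator ≤ regulatorOf ![r.gen₁ h, r.gen₂ h, r.gen₃ h]) ∧
      (AddSubgroup.closure {r.gen₁ h, r.gen₂ h, r.gen₃ h} ⊔ AddCommGroup.torsion _ = ⊤ ↔
        regulatorOf ![r.gen₁ h, r.gen₂ h, r.gen₃ h] = r.curve.regulator) ∧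
      (AddSubgroup.closure {r.gen₁ h, r.gen₂ h, r.gen₃ h} ⊔ AddCommGroup.torsion _ = ⊤ ↔
        regulatorOf ![r.gen₁ h, r.gen₂ h, r.gen₃ h] < 121 * r.curve.regulator) := by
  haveI := isElliptic_of_mem hr
  have hli := (SatCensus.twoSaturated_of_mem_rank3Table hr h).2
  have h11 := fun p hp hd => Rank3Joins112.eleven_le_of_prime_dvd_index_of_rank hr h hrk (p := p) hp hd
  exact ⟨regulatorOf_triple_eq r.curve hli hrk, regulatorOf_triple_dichotomy r.curve hli hrk h11,
    (regulatorOf_triple_eq_regulator_iff r.curve hli hrk).symm,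
    closure_sup_torsion_eq_top_iff_regulatorOf_lt r.curve hli hrk h11⟩

/-- **THE REGULATOR SIDE over GRAND census N9375 (9 375 rows), NO hypothesis**: `Reg(P₁,P₂,P₃) = n²·Reg(E)` with
the table's points, the dichotomy, and `Λ = E(ℚ) ↔ Reg(P) = Reg(E) ↔ Reg(P) < 121·Reg(E)`.
[cite: Siksek1995, §3 (27), p. 1522] [cite: CremonaAlgorithms1997, §3.5, Tables] -/
theorem Rank3Row.regulatorSide_of_mem_rows9375 {r : Rank3Row} (hr : r ∈ Rank3KernelRankCensusN9375.rows)
    (h : r.check = true) :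
    regulatorOf ![r.gen₁ h, r.gen₂ h, r.gen₃ h] =
        ((AddSubgroup.closure {r.gen₁ h, r.gen₂ h, r.gen₃ h} ⊔ AddCommGroup.torsion _).index : ℝ) ^ 2 *
          r.curve.regulator ∧
      (regulatorOf ![r.gen₁ h, r.gen₂ h, r.gen₃ h] = r.curve.regulator ∨
        121 * r.curve.regulator ≤ regulatorOf ![r.gen₁ h, r.gen₂ h, r.gen₃ h]) ∧
      (AddSubgroup.closure {r.gen₁ h, r.gen₂ h, r.gen₃ h} ⊔ AddCommGroup.torsion _ = ⊤ ↔
        regulatorOf ![r.gen₁ h, r.gen₂ h, r.gen₃ h] = r.curve.regulator) ∧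
      (AddSubgroup.closure {r.gen₁ h, r.gen₂ h, r.gen₃ h} ⊔ AddCommGroup.torsion _ = ⊤ ↔
        regulatorOf ![r.gen₁ h, r.gen₂ h, r.gen₃ h] < 121 * r.curve.regulator) :=
  Rank3Row.regulatorSide_of_rank (Rank3KernelRankCensusN9375.mem_rank3Table r hr) h
    (Rank3KernelRankCensusN9375.rank_eq_three r hr)

/-- **Whole table (9 487 rows)**, the 2-descent bound `hup : rank_ℤ ≤ 3` asked ONLY of the 112 residual rows:
`Reg(P₁,P₂,P₃) = n²·Reg(E)`. [cite: Siksek1995, §3 (27), p. 1522] [cite: CremonaAlgorithms1997, §3.5] -/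
theorem Rank3Row.regulatorOf_gens_eq_of_mem_rank3Table112 {r : Rank3Row} (hr : r ∈ rank3Table)
    (h : r.check = true) (hup : r ∈ residualRows112 → r.curve.mordellWeilRank ≤ 3) :
    regulatorOf ![r.gen₁ h, r.gen₂ h, r.gen₃ h] =
      ((AddSubgroup.closure {r.gen₁ h, r.gen₂ h, r.gen₃ h} ⊔ AddCommGroup.torsion _).index : ℝ) ^ 2 *
        r.curve.regulator :=
  (Rank3Row.regulatorSide_of_rank hr h (rank_eq_three_of_mem_rank3Table112 hr hup)).1

/-! ### §2 Granting the register hypothesis («index ≤ 10», or directly `Λ = E(ℚ)`) -/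

/-- **If the listed span is all of `E(ℚ)`, the TABLE's points are a Mordell–Weil basis**, `Reg(E) = Reg(P₁,P₂,P₃)`
and `bsdRHS(E) = #Ш·Reg(P₁,P₂,P₃)·Ω·∏c_p/(#E(ℚ)_tors)²` (any of the 9 487 rows). [cite: CremonaAlgorithms1997, §3.5, Table 4] -/
theorem Rank3Row.regulatorSide_of_listedSpan_eq_top {r : Rank3Row} (hr : r ∈ rank3Table) (h : r.check = true)
    (htop : AddSubgroup.closure {r.gen₁ h, r.gen₂ h, r.gen₃ h} ⊔ AddCommGroup.torsion _ = ⊤) :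
    IsMordellWeilBasis ![r.gen₁ h, r.gen₂ h, r.gen₃ h] ∧
      r.curve.regulator = regulatorOf ![r.gen₁ h, r.gen₂ h, r.gen₃ h] ∧
      r.curve.bsdRHS = (r.curve.shaOrder : ℝ) * regulatorOf ![r.gen₁ h, r.gen₂ h, r.gen₃ h] *
        r.curve.realPeriodRat * (r.curve.tamagawaProduct : ℝ) / (r.curve.torsionOrder : ℝ) ^ 2 := by
  haveI := isElliptic_of_mem hr
  have hB := isMordellWeilBasis_triple r.curve (SatCensus.twoSaturated_of_mem_rank3Table hr h).2 htop
  exact ⟨hB, hB.regulatorOf_eq_regulator.symm, bsdRHS_eq_of_isMordellWeilBasis r.curve hB⟩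

/-- **Granting the engine's register hypothesis «index ≤ 10», per row of N9375**: the table's points are a
Mordell–Weil basis, `Reg(E) = Reg(P₁,P₂,P₃)`, and `bsdRHS(E) = #Ш·Reg(P₁,P₂,P₃)·Ω·∏c_p/(#E(ℚ)_tors)²`.
[cite: CremonaAlgorithms1997, §3.5, Table 4] [cite: CremonaPrickettSiksek2006, Thm 1] -/
theorem Rank3Row.regulatorSide_of_index_le_ten9375 {r : Rank3Row} (hr : r ∈ Rank3KernelRankCensusN9375.rows)
    (h : r.check = true)
    (hB : (AddSubgroup.closure {r.gen₁ h, r.gen₂ h, r.gen₃ h} ⊔ AddCommGroup.torsion _).index ≤ 10) :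
    IsMordellWeilBasis ![r.gen₁ h, r.gen₂ h, r.gen₃ h] ∧
      r.curve.regulator = regulatorOf ![r.gen₁ h, r.gen₂ h, r.gen₃ h] ∧
      r.curve.bsdRHS = (r.curve.shaOrder : ℝ) * regulatorOf ![r.gen₁ h, r.gen₂ h, r.gen₃ h] *
        r.curve.realPeriodRat * (r.curve.tamagawaProduct : ℝ) / (r.curve.torsionOrder : ℝ) ^ 2 :=
  Rank3Row.regulatorSide_of_listedSpan_eq_top (Rank3KernelRankCensusN9375.mem_rank3Table r hr) h
    (Rank3Joins112.listedSpan_eq_top_of_index_le_ten9375 hr h hB)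

/-! ### §3 Granting `BSDConjecture`: the leading term and «analytic Ш» with the TABLE's points -/

/-- **Granting `BSDConjecture` ONLY, per row of N9375, with the TABLE's points `P` and `n` the index of the listed
span: `L‴(E,1) = 6·#Ш·Reg(P)·Ω·∏c_p/((#E(ℚ)_tors)²·n²)` and `#Ш = n² · L‴(E,1)·(#E(ℚ)_tors)²/(6·Reg(P)·Ω·∏c_p)`**
— the «analytic Ш» computed from the listed points is `#Ш/n²`. [cite: CremonaAlgorithms1997, §3.5 and Table 4]
[cite: Wiles2006BSDClay, §1, Remarks 1 (refined conjecture), CMI offprint p. 2] [cite: Siksek1995, §3 (27), p. 1522] -/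
theorem Rank3Row.leadingTerm_gens_of_bsd_of_mem_rows9375 {r : Rank3Row}
    (hr : r ∈ Rank3KernelRankCensusN9375.rows) (h : r.check = true) (hBSD : BSDConjecture) :
    (iteratedDeriv 3 r.curve.entireLFunction 1).re =
        6 * ((r.curve.shaOrder : ℝ) * regulatorOf ![r.gen₁ h, r.gen₂ h, r.gen₃ h] * r.curve.realPeriodRat *
          (r.curve.tamagawaProduct : ℝ) / (r.curve.torsionOrder : ℝ) ^ 2) /
          ((AddSubgroup.closure {r.gen₁ h, r.gen₂ h, r.gen₃ h} ⊔ AddCommGroup.torsion _).index : ℝ) ^ 2 ∧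
      (r.curve.shaOrder : ℝ) =
        ((AddSubgroup.closure {r.gen₁ h, r.gen₂ h, r.gen₃ h} ⊔ AddCommGroup.torsion _).index : ℝ) ^ 2 *
          ((iteratedDeriv 3 r.curve.entireLFunction 1).re * (r.curve.torsionOrder : ℝ) ^ 2 /
            (6 * regulatorOf ![r.gen₁ h, r.gen₂ h, r.gen₃ h] * r.curve.realPeriodRat *
              (r.curve.tamagawaProduct : ℝ))) := by
  have hrt := Rank3KernelRankCensusN9375.mem_rank3Table r hr
  haveI := isElliptic_of_mem hrt
  have key := (Rank3Row.regulatorSide_of_mem_rows9375 hr h).1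
  haveI := (Rank3Joins112.index_coprime_210_of_mem_rows9375 hr h).2.1
  have hn : (((AddSubgroup.closure {r.gen₁ h, r.gen₂ h, r.gen₃ h} ⊔ AddCommGroup.torsion _).index : ℕ) : ℝ) ≠ 0 :=
    by exact_mod_cast AddSubgroup.FiniteIndex.index_ne_zero
  have hR : r.curve.regulator ≠ 0 := r.curve.regulator_pos'.ne'
  have hΩ : r.curve.realPeriodRat ≠ 0 := (realPeriodRat_pos_of_isElliptic r.curve).ne'
  have hc : (r.curve.tamagawaProduct : ℝ) ≠ 0 := by exact_mod_cast r.curve.tamagawaProduct_pos'.ne'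
  have ht : (r.curve.torsionOrder : ℝ) ≠ 0 := by exact_mod_cast r.curve.torsionOrder_pos_holds.ne'
  obtain ⟨-, -, hL, -⟩ := Rank3Row.refinedBSD_of_mem_rows9375 hr hBSD
  have hre : (iteratedDeriv 3 r.curve.entireLFunction 1).re = 6 * r.curve.bsdRHS := by
    rw [hL]; simp
  refine ⟨?_, ?_⟩
  · rw [hre, r.curve.bsdRHS_def, key]; field_simp
  · rw [(Rank3Row.shaOrder_eq_of_bsd_of_mem_rows9375 hr hBSD).2, key]; field_simp

/-- **Granting `BSDConjecture` and «index ≤ 10», per row of N9375: `#Ш(E) = L‴(E,1)·(#E(ℚ)_tors)²/(6·Reg(P)·Ω·∏c_p)`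
EXACTLY, with the regulator of the TABLE's points.** [cite: CremonaAlgorithms1997, §3.5 and Table 4]
[cite: Wiles2006BSDClay, §1, Remarks 1 (refined conjecture), CMI offprint p. 2] -/
theorem Rank3Row.shaOrder_eq_gens_of_bsd_of_index_le_ten9375 {r : Rank3Row}
    (hr : r ∈ Rank3KernelRankCensusN9375.rows) (h : r.check = true) (hBSD : BSDConjecture)
    (hB : (AddSubgroup.closure {r.gen₁ h, r.gen₂ h, r.gen₃ h} ⊔ AddCommGroup.torsion _).index ≤ 10) :
    0 < r.curve.shaOrder ∧ (r.curve.shaOrder : ℝ) =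
      (iteratedDeriv 3 r.curve.entireLFunction 1).re * (r.curve.torsionOrder : ℝ) ^ 2 /
        (6 * regulatorOf ![r.gen₁ h, r.gen₂ h, r.gen₃ h] * r.curve.realPeriodRat *
          (r.curve.tamagawaProduct : ℝ)) := by
  rw [← (Rank3Row.regulatorSide_of_index_le_ten9375 hr h hB).2.1]
  exact Rank3Row.shaOrder_eq_of_bsd_of_mem_rows9375 hr hBSD

/-! ### §4 Row `0` by name: `5077a1` and Buhler–Gross–Zagier's points -/

/-- **The table's listed points of `5077a1` (row `0`) ARE Buhler–Gross–Zagier's `P₁ = (1,0)`, `P₂ = (2,0)`,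
`P₀ = (0,2)`** (in this order). [cite: BuhlerGrossZagier1985, §2 p. 475] [cite: CremonaAlgorithms1997, Tables] -/
theorem curve5077a_gens_eq (h : (rank3Table[0]'(by rw [rank3Table_length]; decide)).check = true) :
    (rank3Table[0]'(by rw [rank3Table_length]; decide)).gen₁ h = Curve5077a.P₁ ∧
      (rank3Table[0]'(by rw [rank3Table_length]; decide)).gen₂ h = Curve5077a.P₂ ∧
      (rank3Table[0]'(by rw [rank3Table_length]; decide)).gen₃ h = Curve5077a.P₀ := by
  unfold Rank3Row.gen₁ Rank3Row.gen₂ Rank3Row.gen₃ Curve5077a.P₀ Curve5077a.P₁ Curve5077a.P₂ Curve5077a.pt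
  refine ⟨?_, ?_, ?_⟩ <;> congr 1 <;> simp [rank3Table_row0_eq]

/-- **`5077a1`, hypothesis-free: `Reg(P₁,P₂,P₀) = n²·Reg(E)`** for BGZ's points, `n = [E(ℚ) : ℤP₁+ℤP₂+ℤP₀+E(ℚ)_tors]`
with every prime factor `≥ 11` (census saturation at `2,3,5,7`; `rank_ℤ = 3` by certificate), the dichotomy, and
**BGZ's «`P₀, P₁, P₂` generate `E(ℚ)`» ⟺ `Reg(P₁,P₂,P₀) = Reg(E)` ⟺ `< 121·Reg(E)`** (no value of either regulator
is claimed). [cite: BuhlerGrossZagier1985, §2 p. 475] [cite: Siksek1995, §3 (27) and Thm. 3.1, pp. 1522–1524] -/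
theorem curve5077a_regulatorSide :
    regulatorOf ![Curve5077a.P₁, Curve5077a.P₂, Curve5077a.P₀] =
        ((AddSubgroup.closure {Curve5077a.P₁, Curve5077a.P₂, Curve5077a.P₀} ⊔
          AddCommGroup.torsion _).index : ℝ) ^ 2 * Curve5077a.E.regulator ∧
      (∀ p : ℕ, p.Prime → p ∣ (AddSubgroup.closure {Curve5077a.P₁, Curve5077a.P₂, Curve5077a.P₀} ⊔
          AddCommGroup.torsion _).index → 11 ≤ p) ∧
      (regulatorOf ![Curve5077a.P₁, Curve5077a.P₂, Curve5077a.P₀] = Curve5077a.E.regulator ∨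
        121 * Curve5077a.E.regulator ≤ regulatorOf ![Curve5077a.P₁, Curve5077a.P₂, Curve5077a.P₀]) ∧
      (AddSubgroup.closure {Curve5077a.P₁, Curve5077a.P₂, Curve5077a.P₀} ⊔ AddCommGroup.torsion _ = ⊤ ↔
        regulatorOf ![Curve5077a.P₁, Curve5077a.P₂, Curve5077a.P₀] = Curve5077a.E.regulator) ∧
      (AddSubgroup.closure {Curve5077a.P₁, Curve5077a.P₂, Curve5077a.P₀} ⊔ AddCommGroup.torsion _ = ⊤ ↔
        regulatorOf ![Curve5077a.P₁, Curve5077a.P₂, Curve5077a.P₀] < 121 * Curve5077a.E.regulator) := by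
  have hrt : rank3Table[0]'(by rw [rank3Table_length]; decide) ∈ rank3Table := List.getElem_mem _
  obtain ⟨e₁, e₂, e₃⟩ := curve5077a_gens_eq (check_of_mem hrt)
  have H := Rank3Row.regulatorSide_of_rank hrt (check_of_mem hrt) mordellWeilRank_row0_eq_three
  have h11 := fun p hp hd => Rank3Joins112.eleven_le_of_prime_dvd_index_of_rank hrt (check_of_mem hrt)
    mordellWeilRank_row0_eq_three (p := p) hp hd
  rw [e₁, e₂, e₃] at H h11
  exact ⟨H.1, h11, H.2⟩

/-! ### §5 Aggregated statement -/

/-- **HEADLINE (the regulator side over GRAND census N9375, no hypothesis).** 9 375 pairwise DISTINCT curves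
with `rank_ℤ E(ℚ) = 3` (kernel), each with three EXPLICIT independent points: `0 < Reg(P₁,P₂,P₃) = n²·Reg(E)`, `n`
the index of `ℤP₁+ℤP₂+ℤP₃+E(ℚ)_tors` with every prime factor `≥ 11`, the dichotomy, and `Λ = E(ℚ) ↔ Reg(P) =
Reg(E)`. [cite: CremonaAlgorithms1997, §3.4, §3.5, Tables] [cite: Siksek1995, §3 (27), p. 1522] -/
theorem regulatorSide_rows9375 :
    ∃ l : List (WeierstrassCurve ℚ), l.Nodup ∧ l.length = 9375 ∧
      ∀ E ∈ l, E.IsElliptic ∧ E.mordellWeilRank = 3 ∧ ∃ P₁ P₂ P₃ : E.toAffine.Point,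
        LinearIndependent ℤ ![P₁, P₂, P₃] ∧ 0 < regulatorOf ![P₁, P₂, P₃] ∧
        regulatorOf ![P₁, P₂, P₃] =
          ((AddSubgroup.closure {P₁, P₂, P₃} ⊔ AddCommGroup.torsion _).index : ℝ) ^ 2 * E.regulator ∧
        (∀ p : ℕ, p.Prime → p ∣ (AddSubgroup.closure {P₁, P₂, P₃} ⊔ AddCommGroup.torsion _).index → 11 ≤ p) ∧
        (regulatorOf ![P₁, P₂, P₃] = E.regulator ∨ 121 * E.regulator ≤ regulatorOf ![P₁, P₂, P₃]) ∧
        (AddSubgroup.closure {P₁, P₂, P₃} ⊔ AddCommGroup.torsion _ = ⊤ ↔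
          regulatorOf ![P₁, P₂, P₃] = E.regulator) := by
  refine ⟨Rank3KernelRankCensusN9375.rows.map Rank3Row.curve, Rank3Joins112.rows9375_curves_nodup,
    by rw [List.length_map, Rank3KernelRankCensusN9375.rows_length], ?_⟩
  intro E hE
  obtain ⟨r, hr, rfl⟩ := List.mem_map.1 hE
  have hrt : r ∈ rank3Table := Rank3KernelRankCensusN9375.mem_rank3Table r hr
  have h := check_of_mem hrt
  have H := Rank3Row.regulatorSide_of_mem_rows9375 hr h
  exact ⟨isElliptic_of_mem hrt, Rank3KernelRankCensusN9375.rank_eq_three r hr, r.gen₁ h, r.gen₂ h, r.gen₃ h,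
    (SatCensus.twoSaturated_of_mem_rank3Table hrt h).2, Rank3Row.regulatorOf_gens_pos_of_mem hrt h, H.1,
    fun p hp hd => Rank3Joins112.eleven_le_of_prime_dvd_index9375 hr h hp hd, H.2.1, H.2.2.1⟩

end Summit.BirchSwinnertonDyer.BirchSwinnertonDyer.Rank2Observatory
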